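import Summits.KontsevichZagierPeriods.KontsevichZagierPeriods.Theorems.RootDecompQuadraticDescentEulerShear

/-!
# Euler's reflection `ζ(2) = 2·Li₂(½) + log²2` BY THE MOVES, inside dimension 2 — part 2/4: the dissections `T = L ⊔ B`, `B = P₁ ⊔ P₂` (rule 1a) and MOVE 2, the affine involution `(x,y) ↦ (1−y,1−x)` carrying `P₂` onto `L⁺`

Theorems-split (≤ 400 lines each) of the decomp-kz lens-6 gen-4 file
`run/shared/lean/pub/decomp-kz/decomp-kz-lens-6/g4/RootDecompQuadraticDescentEulerReflection.lean` (1018 lines, critic re-check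
2026-08-30T04:40:16Z: rc0, axioms(eulerReflection_byMoves) = {propext, Classical.choice, Quot.sound}); parts:
`…EulerShear` → `…EulerDissect` → `…EulerReflection` → `…EulerCensus`. Support for item stmt-KontsevichZagierPeriods-26540
(QuadraticDescent) and a decided ≥3-term dimension-2 instance for stmt-KontsevichZagierPeriods-4280.
Sources: Euler 1768; L. Lewin, *Polylogarithms and associated functions* (1981) §1.5; D. Zagier, *The dilogarithm function* (2007)
§I.1–I.2; M. Kontsevich, D. Zagier, *Periods* (2001) §1.1, §1.2 (rules 1a, 1b, 2).
-/

noncomputable section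

set_option linter.dupNamespace false

open MeasureTheory Set
open MvPolynomial (aeval X C)
open Literature.ModelTheory.ExponentialFields (IsSemialgebraic tarski_seidenberg_real_holds)

namespace Summit.KontsevichZagierPeriods.KontsevichZagierPeriods.Theorems.RootDecompQuadraticDescentEulerReflection

open Literature.NumberTheory.Transcendental
open Literature.NumberTheory.Transcendental.KZ

/-! ### Dissections (rule 1a): `T = L ⊔ B`, `B = P₁ ⊔ P₂` -/

/-- The `Li₂(½)` triangle `L = {0 < y < x < ½}`. -/
def L : Set (Fin 2 → ℝ) := {z | 0 < z 1 ∧ z 1 < z 0 ∧ z 0 < 1 / 2}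

/-- The lower half-plane `{y < ½}`. -/
def Hlow : Set (Fin 2 → ℝ) := {z | z 1 < 1 / 2}

/-- `L` is `ℚ`-semialgebraic. [BCR1998 §2.2] -/
lemma isSemialgebraic_L : IsSemialgebraic ℚ L := by
  have h := isSemialgebraic_setOf_forall_aeval_pos
    ![(X 1 : MvPolynomial (Fin 2) ℚ), X 0 - X 1, C (1/2) - X 0]
  convert h using 1
  ext z
  simp only [L, mem_setOf_eq, Fin.forall_fin_succ, Matrix.cons_val_zero, Matrix.cons_val_succ, map_sub,
    MvPolynomial.aeval_X, MvPolynomial.aeval_C, eq_ratCast, sub_pos, IsEmpty.forall_iff, and_true]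
  norm_num

/-- `Hlow` is `ℚ`-semialgebraic. [BCR1998 §2.2] -/
lemma isSemialgebraic_Hlow : IsSemialgebraic ℚ Hlow := by
  have h := isSemialgebraic_setOf_forall_aeval_pos ![(C (1/2) - X 1 : MvPolynomial (Fin 2) ℚ)]
  convert h using 1
  ext z
  simp only [Hlow, mem_setOf_eq, Fin.forall_fin_succ, Matrix.cons_val_zero, map_sub,
    MvPolynomial.aeval_X, MvPolynomial.aeval_C, eq_ratCast, sub_pos, IsEmpty.forall_iff, and_true]
  norm_num

/-- `L ⊆ T`. [bookkeeping] -/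
lemma L_subset_T : L ⊆ T := fun z ⟨h0, h1, h2⟩ => ⟨h0, h1, by linarith⟩

/-- `B := T ∖ L = {½ ≤ x < 1, 0 < y < x}`. -/
def B : Set (Fin 2 → ℝ) := T \ L
/-- `P₁ := B ∩ {y < ½}` (the rectangle `[½,1) × (0,½)`). -/
def P₁ : Set (Fin 2 → ℝ) := B ∩ Hlow
/-- `P₂ := B ∖ {y < ½}` (the triangle `{½ ≤ y < x < 1}`). -/
def P₂ : Set (Fin 2 → ℝ) := B \ Hlow

/-- `B` is `ℚ`-semialgebraic. [BCR1998 §2.2] -/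
lemma isSemialgebraic_B : IsSemialgebraic ℚ B := isSemialgebraic_T.diff isSemialgebraic_L
/-- `P₁` is `ℚ`-semialgebraic. [BCR1998 §2.2] -/
lemma isSemialgebraic_P₁ : IsSemialgebraic ℚ P₁ := isSemialgebraic_B.inter isSemialgebraic_Hlow
/-- `P₂` is `ℚ`-semialgebraic. [BCR1998 §2.2] -/
lemma isSemialgebraic_P₂ : IsSemialgebraic ℚ P₂ := isSemialgebraic_B.diff isSemialgebraic_Hlow
/-- `B ⊆ T`. [bookkeeping] -/
lemma B_subset_T : B ⊆ T := sdiff_subset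
/-- `P₁ ⊆ T`. [bookkeeping] -/
lemma P₁_subset_T : P₁ ⊆ T := fun _ hz => hz.1.1
/-- `P₂ ⊆ T`. [bookkeeping] -/
lemma P₂_subset_T : P₂ ⊆ T := fun _ hz => hz.1.1

/-- Membership in `B`, unfolded. [bookkeeping] -/
lemma mem_B {z : Fin 2 → ℝ} : z ∈ B ↔ 0 < z 1 ∧ z 1 < z 0 ∧ z 0 < 1 ∧ 1 / 2 ≤ z 0 := by
  simp only [B, T, L, mem_sdiff, mem_setOf_eq, not_and, not_lt]
  constructor
  · rintro ⟨⟨h0, h1, h2⟩, h⟩; exact ⟨h0, h1, h2, h h0 h1⟩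
  · rintro ⟨h0, h1, h2, h3⟩; exact ⟨⟨h0, h1, h2⟩, fun _ _ => h3⟩

/-- Membership in `P₂`, unfolded. [bookkeeping] -/
lemma mem_P₂ {z : Fin 2 → ℝ} : z ∈ P₂ ↔ 0 < z 1 ∧ z 1 < z 0 ∧ z 0 < 1 ∧ 1 / 2 ≤ z 1 := by
  simp only [P₂, mem_sdiff, mem_B, Hlow, mem_setOf_eq, not_lt]
  constructor
  · rintro ⟨⟨h0, h1, h2, h3⟩, h4⟩; exact ⟨h0, h1, h2, h4⟩
  · rintro ⟨h0, h1, h2, h4⟩; exact ⟨⟨h0, h1, h2, by linarith⟩, h4⟩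

/-- Membership in `P₁`, unfolded. [bookkeeping] -/
lemma mem_P₁ {z : Fin 2 → ℝ} : z ∈ P₁ ↔ 0 < z 1 ∧ z 1 < 1 / 2 ∧ 1 / 2 ≤ z 0 ∧ z 0 < 1 := by
  simp only [P₁, mem_inter_iff, mem_B, Hlow, mem_setOf_eq]
  constructor
  · rintro ⟨⟨h0, h1, h2, h3⟩, h4⟩; exact ⟨h0, h4, h3, h2⟩
  · rintro ⟨h0, h4, h3, h2⟩; exact ⟨⟨h0, by linarith, h2, h3⟩, h4⟩

/-- Auxiliary step `Ltri`. [bookkeeping] -/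
def Ltri : KZ.IntegralRep 2 := Ttri.restrict L isSemialgebraic_L L_subset_T
/-- Auxiliary step `Btri`. [bookkeeping] -/
def Btri : KZ.IntegralRep 2 := Ttri.restrict B isSemialgebraic_B B_subset_T
/-- Auxiliary step `P₁tri`. [bookkeeping] -/
def P₁tri : KZ.IntegralRep 2 := Ttri.restrict P₁ isSemialgebraic_P₁ P₁_subset_T
/-- Auxiliary step `P₂tri`. [bookkeeping] -/
def P₂tri : KZ.IntegralRep 2 := Ttri.restrict P₂ isSemialgebraic_P₂ P₂_subset_T

/-- `restrict_Ttri` is KZ-rational. [bookkeeping] -/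
lemma isRational_restrict_Ttri {s : Set (Fin 2 → ℝ)} (hs : IsSemialgebraic ℚ s) (hsT : s ⊆ T) :
    (Ttri.restrict s hs hsT).IsRational :=
  ⟨1, (1 - X 1) * X 0, fun x hx => by simpa using den_ne_zero_of_mem_T (hsT hx), fun x _ => by
    simp [KZ.IntegralRep.integrand_restrict, integrand_Ttri]⟩

/-- `Ltri` is KZ-rational. [bookkeeping] -/
lemma isRational_Ltri : Ltri.IsRational := isRational_restrict_Ttri _ _

/-- SPLIT 1 (rule 1a): `[Ttri] − [Ltri] − [Btri] ∈ KZ.relations`. -/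
theorem split₁_mem : of Ttri - of Ltri - of Btri ∈ KZ.relations := by
  refine domainAddRel_subset_relations ⟨2, Ttri, Ltri, Btri, ?_, ?_, fun _ _ => rfl, fun _ _ => rfl, rfl⟩
  · change T = L ∪ (T \ L)
    rw [union_sdiff_cancel L_subset_T]
  · change volume (L ∩ (T \ L)) = 0
    rw [inter_sdiff_self, measure_empty]

/-- SPLIT 2 (rule 1a): `[Btri] − [P₁tri] − [P₂tri] ∈ KZ.relations`. -/
theorem split₂_mem : of Btri - of P₁tri - of P₂tri ∈ KZ.relations := by
  refine domainAddRel_subset_relations ⟨2, Btri, P₁tri, P₂tri, ?_, ?_, fun _ _ => rfl, fun _ _ => rfl, rfl⟩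
  · change B = B ∩ Hlow ∪ B \ Hlow
    rw [inter_union_sdiff]
  · change volume (B ∩ Hlow ∩ (B \ Hlow)) = 0
    have : B ∩ Hlow ∩ (B \ Hlow) = ∅ := by
      ext z; simp only [mem_inter_iff, mem_sdiff, mem_empty_iff_false, iff_false]; tauto
    rw [this, measure_empty]

/-! ### MOVE 2 (rule 2, the affine involution `(x,y) ↦ (1−y,1−x)`): `P₂ → L⁺ = {0 < y < x ≤ ½}` -/

/-- `L⁺ := T ∖ {½ < x} = {0 < y < x ≤ ½}` (= `L` up to the null segment `x = ½`). -/
def Lplus : Set (Fin 2 → ℝ) := T \ {z | 1 / 2 < z 0}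

/-- `Lplus` is `ℚ`-semialgebraic. [BCR1998 §2.2] -/
lemma isSemialgebraic_Lplus : IsSemialgebraic ℚ Lplus := by
  refine isSemialgebraic_T.diff ?_
  have h := isSemialgebraic_setOf_forall_aeval_pos ![(X 0 - C (1/2) : MvPolynomial (Fin 2) ℚ)]
  convert h using 1
  ext z
  simp only [mem_setOf_eq, Fin.forall_fin_succ, Matrix.cons_val_zero, map_sub,
    MvPolynomial.aeval_X, MvPolynomial.aeval_C, eq_ratCast, sub_pos, IsEmpty.forall_iff, and_true]
  norm_num

/-- `Lplus ⊆ T`. [bookkeeping] -/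
lemma Lplus_subset_T : Lplus ⊆ T := sdiff_subset

/-- Membership in `Lplus`, unfolded. [bookkeeping] -/
lemma mem_Lplus {z : Fin 2 → ℝ} : z ∈ Lplus ↔ 0 < z 1 ∧ z 1 < z 0 ∧ z 0 ≤ 1 / 2 := by
  simp only [Lplus, T, mem_sdiff, mem_setOf_eq, not_lt]
  constructor
  · rintro ⟨⟨h0, h1, h2⟩, h3⟩; exact ⟨h0, h1, h3⟩
  · rintro ⟨h0, h1, h3⟩; exact ⟨⟨h0, h1, by linarith⟩, h3⟩

/-- Auxiliary step `Lplustri`. [bookkeeping] -/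
def Lplustri : KZ.IntegralRep 2 := Ttri.restrict Lplus isSemialgebraic_Lplus Lplus_subset_T

/-- Auxiliary step `exists_reflChart`. [bookkeeping] -/
theorem exists_reflChart :
    ∃ (Ψ : (Fin 2 → ℝ) → (Fin 2 → ℝ)) (M : (Fin 2 → ℝ) →L[ℝ] (Fin 2 → ℝ)),
      (∀ z, Ψ z 0 = 1 - z 1) ∧ (∀ z, Ψ z 1 = 1 - z 0) ∧
      IsSemialgebraicMapOn ℚ P₂ Ψ ∧ (∀ z, HasFDerivAt Ψ M z) ∧ Set.InjOn Ψ P₂ ∧ Ψ '' P₂ = Lplus ∧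
      M.det = -1 := by
  set Ψ : (Fin 2 → ℝ) → (Fin 2 → ℝ) := fun z => ![1 - z 1, 1 - z 0] with hΨ
  set M : (Fin 2 → ℝ) →L[ℝ] (Fin 2 → ℝ) :=
    LinearMap.toContinuousLinearMap (Matrix.toLin' !![0, -1; -1, 0]) with hM
  have hΨ0 : ∀ z, Ψ z 0 = 1 - z 1 := fun z => rfl
  have hΨ1 : ∀ z, Ψ z 1 = 1 - z 0 := fun z => rfl
  have hM0 : ∀ v : Fin 2 → ℝ, M v 0 = -v 1 := by
    intro v
    change Matrix.toLin' !![(0:ℝ), -1; -1, 0] v 0 = _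
    rw [Matrix.toLin'_apply]
    simp [Matrix.mulVec, dotProduct, Fin.sum_univ_two]
  have hM1 : ∀ v : Fin 2 → ℝ, M v 1 = -v 0 := by
    intro v
    change Matrix.toLin' !![(0:ℝ), -1; -1, 0] v 1 = _
    rw [Matrix.toLin'_apply]
    simp [Matrix.mulVec, dotProduct, Fin.sum_univ_two]
  have hdet : M.det = -1 := by
    change LinearMap.det (Matrix.toLin' !![(0:ℝ), -1; -1, 0]) = _
    rw [LinearMap.det_toLin', Matrix.det_fin_two]
    simp
  have hderiv : ∀ z, HasFDerivAt Ψ M z := by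
    intro z
    have h0 : HasFDerivAt (fun y : Fin 2 → ℝ => y 0)
        (ContinuousLinearMap.proj (R := ℝ) (φ := fun _ : Fin 2 => ℝ) 0) z := hasFDerivAt_apply 0 z
    have h1 : HasFDerivAt (fun y : Fin 2 → ℝ => y 1)
        (ContinuousLinearMap.proj (R := ℝ) (φ := fun _ : Fin 2 => ℝ) 1) z := hasFDerivAt_apply 1 z
    rw [hasFDerivAt_pi']
    refine Fin.forall_fin_two.mpr ⟨?_, ?_⟩
    · have hf : (fun y : Fin 2 → ℝ => Ψ y 0) = fun y => 1 - y 1 := funext fun y => rfl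
      rw [hf]
      refine (h1.const_sub 1).congr_fderiv (ContinuousLinearMap.ext fun v => ?_)
      simp [hM0]
    · have hf : (fun y : Fin 2 → ℝ => Ψ y 1) = fun y => 1 - y 0 := funext fun y => rfl
      rw [hf]
      refine (h0.const_sub 1).congr_fderiv (ContinuousLinearMap.ext fun v => ?_)
      simp [hM1]
  refine ⟨Ψ, M, hΨ0, hΨ1, ?_, hderiv, ?_, ?_, hdet⟩
  · convert isSemialgebraicMapOn_aeval isSemialgebraic_P₂
      ![(1 - MvPolynomial.X 1 : MvPolynomial (Fin 2) ℚ), 1 - MvPolynomial.X 0] using 2 with z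
    funext i
    fin_cases i
    · simp [hΨ0]
    · simp [hΨ1]
  · intro x _ y _ hxy
    have e0 := congrFun hxy 0
    have e1 := congrFun hxy 1
    simp only [hΨ0, hΨ1] at e0 e1
    funext i
    fin_cases i
    · change x 0 = y 0; linarith
    · change x 1 = y 1; linarith
  · ext w
    constructor
    · rintro ⟨z, hz, rfl⟩
      rw [mem_P₂] at hz
      obtain ⟨h0, h1, h2, h3⟩ := hz
      rw [mem_Lplus]
      simp only [hΨ0, hΨ1]
      exact ⟨by linarith, by linarith, by linarith⟩
    · intro hw
      rw [mem_Lplus] at hw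
      obtain ⟨h0, h1, h2⟩ := hw
      refine ⟨![1 - w 1, 1 - w 0], ?_, ?_⟩
      · rw [mem_P₂]
        simp only [Matrix.cons_val_zero, Matrix.cons_val_one]
        exact ⟨by linarith, by linarith, by linarith, by linarith⟩
      · funext i
        fin_cases i
        · change 1 - (1 - w 0) = w 0; ring
        · change 1 - (1 - w 1) = w 1; ring

/-- MOVE 2: `[P₂tri] − [Lplustri] ∈ KZ.relations`. -/
theorem P₂tri_sub_Lplustri_mem : of P₂tri - of Lplustri ∈ KZ.relations := by
  obtain ⟨Ψ, M, hΨ0, hΨ1, hsa, hderiv, hinj, himage, hdet⟩ := exists_reflChart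
  refine changeOfVariablesRel_subset_relations ⟨2, P₂tri, Lplustri, Ψ, fun _ => M, hsa,
    fun z _ => (hderiv z).hasFDerivWithinAt, hinj, himage.symm, fun z hz => ?_, rfl⟩
  have hz' : z ∈ P₂ := hz
  rw [mem_P₂] at hz'
  obtain ⟨h0, h1, h2, h3⟩ := hz'
  change Ttri.integrand z = Ttri.integrand (Ψ z) * |M.det|
  rw [integrand_Ttri, hdet]
  simp only [hΨ0, hΨ1, abs_neg, abs_one, mul_one]
  ring

/-- NULL ADJUSTMENT: `[Lplustri] − [Ltri] ∈ KZ.relations` (the segment `x = ½` is null). -/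
theorem Lplustri_sub_Ltri_mem : of Lplustri - of Ltri ∈ KZ.relations := by
  refine KZ.of_sub_of_mem_relations_of_null Lplustri Ltri ?_ ?_ fun _ _ => rfl
  · change volume (Lplus \ L) = 0
    refine measure_mono_null (fun z hz => ?_) (BallPeeling.volume_setOf_apply_eq_const 2 0 (1/2))
    have h1 := mem_Lplus.mp hz.1
    have h2 : ¬ (0 < z 1 ∧ z 1 < z 0 ∧ z 0 < 1 / 2) := hz.2
    change z 0 = 1 / 2
    by_contra hne
    exact h2 ⟨h1.1, h1.2.1, lt_of_le_of_ne h1.2.2 hne⟩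
  · change volume (L \ Lplus) = 0
    have : L \ Lplus = ∅ := by
      ext z
      simp only [mem_sdiff, mem_empty_iff_false, iff_false, not_and, not_not]
      intro hz
      exact mem_Lplus.mpr ⟨hz.1, hz.2.1, hz.2.2.le⟩
    rw [this, measure_empty]

end Summit.KontsevichZagierPeriods.KontsevichZagierPeriods.Theorems.RootDecompQuadraticDescentEulerReflection
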